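import Literature.NumberTheory.Automorphic.CaraianiNewtonModularity
import HarnessLib

/-!
# Freitas–Le Hung–Siksek: modularity of elliptic curves over real quadratic fields, and over
# any totally real field up to finitely many `j`-invariants (named facts)

Topic `NumberTheory/Automorphic` (companion of `CaraianiNewtonModularity.lean`, whose predicate
`IsModularEllipticCurve F E` — "(geometric) CM, or a weight-zero cuspidal `π` of `GL₂(𝔸_F)` whose
`T_w`-eigenvalue is `a_w(E)` at all but finitely many `w`" — we reuse verbatim, with `F = K` totally
real). NAMED FACTS (D-0014, `def … : Prop`, not asserted, no `sorry`) requested while grounding route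
`Langlands/Langlands/AdjointEulerNumerical` (ledger `route-Langlands-AdjointEulerNumerical`): its
crux `TotallyRealWeightZeroAutomorphic` (stmt-Langlands-2176) asserts that EVERY elliptic curve over
EVERY totally real field is automorphic of weight zero; the printed state of the art it must be
measured against is Theorem 1 (real quadratic fields: all curves) and Theorem 5 (any totally real
field: all but finitely many `K̄`-isomorphism classes) below. (Cubic fields: Derickx–Najman–Siksek
2020; quartic fields not containing `√5`: Box 2022 — not vendored here.)

## Source and what is printed

N. Freitas, B. V. Le Hung, S. Siksek, *Elliptic curves over real quadratic fields are modular*,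
Invent. Math. 201 (2015) 159–206 = arXiv:1310.7088 [FreitasLeHungSiksek2015]; read 2026-08-15
from the arXiv text (`lit read arxiv:1310.7088`, pp. 4–5 of the text layer):

* Definition (p. 4): "Let `K` be a totally real number field … Let `E` be an elliptic curve over
  `K`. Recall that `E` is modular if there exists a Hilbert cuspidal eigenform `𝔣` over `K` of
  parallel weight `2`, with rational Hecke eigenvalues, such that the Hasse–Weil L-function of `E`
  is equal to the L-function of `𝔣`. A more conceptual way to phrase this is that there is an
  isomorphism of compatible systems of Galois representations `ρ_{E,p} ≅ ρ_{𝔣,p}`".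
* **Theorem 1** (p. 4): "Let `E` be an elliptic curve over a real quadratic field `K`. Then `E` is
  modular."
* Theorem 3 (p. 4): "Let `p = 3` or `5`. Let `E` be an elliptic curve over a totally real field
  `K`. Suppose that `ρ̄_{E,p}(G_{K(ζ_p)})` is absolutely irreducible. Then `E` is modular."
  Theorem 4 (p. 5): the same for `p = 7`. "… an elliptic curve `E` over a totally real field `K`
  is modular except possibly if the images `ρ̄_{E,p}(G_{K(ζ_p)})` are simultaneously absolutely
  reducible for `p = 3, 5, 7` … such an elliptic curve gives rise to a `K`-point on one of `27`
  modular curves … [which] possess only finitely many `K`-points."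
* **Theorem 5** (p. 5): "Let `K` be a totally real field. All but finitely many `K̄`-isomorphism
  classes of elliptic curves over `K` are modular."

## Design (read before citing)

* The printed "modular" (equality of L-functions with a parallel-weight-2 Hilbert eigenform, i.e.
  `ρ_{E,p} ≅ ρ_{𝔣,p}`) IMPLIES the tree's `IsModularEllipticCurve K E` (the cofinite shadow:
  `T_w`-eigenvalue `= a_w(E)` at almost all `w`, or CM), via the dictionary Hilbert eigenform ↔
  weight-zero cuspidal `π` of `GL₂(𝔸_K)`; so each fact below is AT MOST AS STRONG as the printed
  theorem (conservative vendoring, same convention as `CaraianiNewton2023_modularity`). The CM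
  disjunct of `IsModularEllipticCurve` is harmless here: over a totally real `K` a CM curve is
  modular in the printed sense too (automorphic induction from the CM field, which is a proper
  CM extension of `K`).
* Elliptic curves over `K` are rendered, as in lang.S28 and `CaraianiNewtonModularity`, by integral
  Weierstrass models `E : WeierstrassCurve (𝓞 K)` with `E.Δ ≠ 0` (every `E/K` has such a model;
  modularity is an isogeny-, a fortiori a model-invariant).
* "real quadratic field" = `NumberField.IsTotallyReal K ∧ Module.finrank ℚ K = 2`.
* Theorem 5's "`K̄`-isomorphism classes" are the `j`-invariants: the fact says there is a finite
  set `J ⊆ K` such that every `E` with `j(E) = c₄(E)³/Δ(E) ∉ J` (computed in `K`) is modular —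
  exactly "all but finitely many `K̄`-isomorphism classes" (two curves over `K` are
  `K̄`-isomorphic iff they have the same `j`-invariant).
* Theorems 2–4 (modularity lifting / residual-image criteria) are NOT vendored: they need the
  mod-`p` representation `ρ̄_{E,p}` and "absolutely irreducible on `G_{K(ζ_p)}`" as typed objects.

## What these facts ground

`Summit.Langlands.Langlands.Theses.AdjointEulerNumerical.TotallyRealWeightZeroAutomorphic`
(stmt-Langlands-2176) is STRONGER than both facts in three ways, to be recorded on the item, not
hidden: (i) every totally real `K` and every curve (print: degree `2`, or cofinitely many `j` per
field; degree `3`: DNS 2020; degree `4` without `√5`: Box 2022), (ii) its conclusion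
`IsAutomorphicOfWeightZero E` asks the Hecke polynomial `X² − a_w X + q_w` at EVERY `w ∤ Δ(E)`, not
at almost every `w` (the upgrade is local–global compatibility for Hilbert modular forms at good
places — Carayol 1986 / Taylor 1989 — printed, not vendored), (iii) no CM escape clause.

## Mathlib / tree search

Tree: `IsModularEllipticCurve`, `CaraianiNewton2023_modularity` (imaginary quadratic, `X₀(15)(F)`
finite), `potentiallyModular_ellipticCurve_CM` (ACC+ 2023), `IsAutomorphicOfWeightZero`
(`ReciprocityGLnPotentialModularity.lean:260`); nothing on totally real fields of degree `≥ 2`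
(searched `1310.7088`, `Freitas`, `Siksek`, `IsTotallyReal.*Modular`). Mathlib: `WeierstrassCurve.c₄`,
`WeierstrassCurve.Δ`, `NumberField.IsTotallyReal`. Users take `(h : FreitasLeHungSiksek2015_thm1)`.
-/

noncomputable section

namespace Literature.NumberTheory.Automorphic

open NumberField

/-- **Freitas–Le Hung–Siksek 2015, Theorem 1: elliptic curves over real quadratic fields are
modular.** For every totally real number field `K` of degree `2` and every integral Weierstrass
model `E` over `𝓞 K` with `Δ(E) ≠ 0`, `E/K` is modular (`IsModularEllipticCurve K E`, the
cofinite-trace rendering — implied by the printed L-function equality). Statement only.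
[cite: FreitasLeHungSiksek2015, Thm. 1] -/
def FreitasLeHungSiksek2015_thm1 : Prop :=
  ∀ (K : Type) [Field K] [NumberField K] [IsTotallyReal K], Module.finrank ℚ K = 2 →
    ∀ E : WeierstrassCurve (𝓞 K), E.Δ ≠ 0 → IsModularEllipticCurve K E

/-- **Freitas–Le Hung–Siksek 2015, Theorem 5: over a totally real field all but finitely many
`K̄`-isomorphism classes of elliptic curves are modular.** For every totally real number field `K`
there is a finite set `J ⊆ K` of `j`-invariants such that every integral Weierstrass model `E` over
`𝓞 K` with `Δ(E) ≠ 0` and `j(E) = c₄(E)³/Δ(E) ∉ J` is modular (`IsModularEllipticCurve K E`).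
Statement only. [cite: FreitasLeHungSiksek2015, Thm. 5] -/
def FreitasLeHungSiksek2015_thm5 : Prop :=
  ∀ (K : Type) [Field K] [NumberField K] [IsTotallyReal K], ∃ J : Finset K,
    ∀ E : WeierstrassCurve (𝓞 K), E.Δ ≠ 0 →
      (algebraMap (𝓞 K) K E.c₄) ^ 3 / algebraMap (𝓞 K) K E.Δ ∉ J → IsModularEllipticCurve K E

/-! ### Proved API (session 2026-08-15): the content of Theorem 1 is the non-CM automorphic
existence; comparison with the summit-side shape and with Theorem 5

No discharge `FreitasLeHungSiksek2015_thm1_holds` is possible in the tree today (the printed proof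
— modularity lifting after Breuil–Diamond/Kisin/Barnet-Lamb–Gee–Geraghty, Langlands–Tunnell,
3–5 and 3–7 modularity switching, and the enumeration of real quadratic points on eleven modular
curves, [FreitasLeHungSiksek2015, §§2–5] — rests on theories absent from Mathlib/Literature); the
three lemmas below are the formal bookkeeping around the fact, each a one-line unfolding. -/

/-- **Theorem 1 reduces to its non-CM case** (unfolding of `IsModularEllipticCurve`): the
vendored statement is equivalent to — for every real quadratic `K` and every integral model `E`
with `Δ(E) ≠ 0` and no geometric CM there is a weight-zero cuspidal `π` on `GL₂(𝔸_K)` whose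
`T_w`-eigenvalue `q_w^{1/2}(α_w + β_w)` is `a_w(E)` for all but finitely many `w`. (In print the
CM case is covered by the theorem itself; in the tree's rendering it is the first disjunct of
`IsModularEllipticCurve`.) [folklore] -/
theorem FreitasLeHungSiksek2015_thm1_iff_forall_not_hasCM :
    FreitasLeHungSiksek2015_thm1 ↔
      ∀ (K : Type) [Field K] [NumberField K] [IsTotallyReal K], Module.finrank ℚ K = 2 →
        ∀ E : WeierstrassCurve (𝓞 K), E.Δ ≠ 0 → ¬ (E.baseChange K).HasCM →
          ∃ (hF : isCompact_glFiniteIntegralLevel 2 K) (π : CuspidalAutomorphicRepData 2 K hF),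
            π.1.HasWeightZero ∧
              ∀ᶠ w : IsDedekindDomain.HeightOneSpectrum (𝓞 K) in Filter.cofinite,
                ∃ α : Multiset ℂ, π.1.HasSatakeParamAt w α ∧
                  ((Real.sqrt w.residueCard : ℝ) : ℂ) * α.sum = (frobTraceAt E w : ℂ) := by
  constructor
  · intro h K _ _ _ hK E hΔ hCM
    exact (h K hK E hΔ).resolve_left hCM
  · intro h K _ _ _ hK E hΔ
    by_cases hCM : (E.baseChange K).HasCM
    · exact Or.inl hCM
    · exact Or.inr (h K hK E hΔ hCM)

/-- **The summit-side shape implies Theorem 1 as vendored.** If every integral model with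
`Δ ≠ 0` over every real quadratic field is automorphic of weight zero in the strong sense
`IsAutomorphicOfWeightZero` (Hecke polynomial `X² - a_w X + q_w` at *every* `w ∤ Δ(E)`, no CM
escape clause — the degree-`2` case of the crux `TotallyRealWeightZeroAutomorphic` of route
Langlands/AdjointEulerNumerical), then `FreitasLeHungSiksek2015_thm1` holds, by
`IsModularEllipticCurve.of_isAutomorphicOfWeightZero`. This records, inside the tree, that the
crux is at least as strong as the printed Theorem 1 in degree `2` (cf. the module docstring,
"What these facts ground"). It is NOT a discharge of the fact. [folklore] -/
theorem FreitasLeHungSiksek2015_thm1_of_forall_isAutomorphicOfWeightZero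
    (h : ∀ (K : Type) [Field K] [NumberField K] [IsTotallyReal K], Module.finrank ℚ K = 2 →
      ∀ E : WeierstrassCurve (𝓞 K), E.Δ ≠ 0 → IsAutomorphicOfWeightZero E) :
    FreitasLeHungSiksek2015_thm1 :=
  fun K _ _ _ hK E hΔ ↦ IsModularEllipticCurve.of_isAutomorphicOfWeightZero hΔ (h K hK E hΔ)

/-- **Theorem 1 gives Theorem 5 over real quadratic fields with empty exceptional set**: from
`FreitasLeHungSiksek2015_thm1`, for a real quadratic `K` the conclusion of
`FreitasLeHungSiksek2015_thm5` holds with `J = ∅`. [folklore] -/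
theorem FreitasLeHungSiksek2015_thm1.exists_finset_of_finrank_eq_two
    (h : FreitasLeHungSiksek2015_thm1) (K : Type) [Field K] [NumberField K] [IsTotallyReal K]
    (hK : Module.finrank ℚ K = 2) :
    ∃ J : Finset K, ∀ E : WeierstrassCurve (𝓞 K), E.Δ ≠ 0 →
      (algebraMap (𝓞 K) K E.c₄) ^ 3 / algebraMap (𝓞 K) K E.Δ ∉ J → IsModularEllipticCurve K E :=
  ⟨∅, fun E hΔ _ ↦ h K hK E hΔ⟩

end Literature.NumberTheory.Automorphic

end
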